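import Summits.AtomisticToContinuum.HydrodynamicLimit.Theorems.AprioriBounds.Negative.ExpMomentTangent
import Summits.AtomisticToContinuum.HydrodynamicLimit.Theorems.AprioriBounds.Negative.BlockDensityAveraging
import Summits.AtomisticToContinuum.HydrodynamicLimit.Theorems.AprioriBounds.Negative.AdmissibleKernel
import Literature.Analysis.FluidPDE.HardSphereAlexander
import Literature.Analysis.FluidPDE.HardSphereFlowRegular
import Literature.Analysis.FluidPDE.HardSpherePhaseSpaceProofs
import Literature.Analysis.FluidPDE.HardSphereTrajectoryMeasurable

/-!
# `AprioriBounds` (stmt-AtomisticToContinuum-9519, the `∀ t > 0` form) is false modulo `PersistentVacuum`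

Negative lemma MODULO A HYPOTHESIS (refuter cdisprove, cycle 3), the component-(ii) twin of
`AprioriBounds_false_of_PersistentHotSpot` with a strictly WEAKER kind of hypothesis: only the tested
empirical DENSITY is assumed to obey a space–time law of large numbers on some window `[t₁, t₂]`, toward a
window-integrated limit density `ρI` that has VACUUM in the tested sense — for every level `c > 0` some
continuous `0 ≤ χ ≤ 1` with `∫ χ > 0` has `∫ χ ρI < c ∫ χ` (e.g. `ρI` continuous with a zero: the centre
behind the reflected shock of a Guderley implosion, where gas dynamics predicts `ρ ∝ r^κ`, `κ > 0`, for all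
times after the focus; or a cavitating flow).  Component (ii) of the crux claims, for every `t > 0` and every
admissible kernel family, a floor `c₁ > 0` under ALL mesoscopic block densities at ALL times `s ≤ t`
w.h.p.; but a block floor `c₁` forces the tested mass `(N+1)⁻¹∑ᵢ χ(xᵢ(s)) ≥ c₁ ∫χ − o(1)` for every
continuous `χ ≥ 0` (deterministic: `le_empiricalDensityField_of_blockFloor`, the kernels being approximate
identities), hence `∫_{t₁}^{t₂} (N+1)⁻¹∑ᵢ χ(xᵢ(s)) ds ≥ (t₂ − t₁)(c₁∫χ − o(1))`, contradicting the law of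
large numbers at a vacuum.  So `PersistentVacuum → ¬ AprioriBounds`
(`AprioriBounds_false_of_PersistentVacuum`).  As for the hot spot, nobody can construct the hypothesis
today (a hydrodynamic limit through a collapse / into a cavity); the item stays open; the lemma records
that the `∀ t > 0` exposure hits BOTH halves of the crux, (ii) through its floor `c₁ ≤ ρ̄`, and with
density information alone.  Repair (the witness misses it): `t < T` of the classical solution
(`Cruxes/AprioriBounds/Disproof.lean` §6) — adopted at route rev 12/13 (2026-08-16): the route declaration
`…Theses.CollisionIsometryCLT.AprioriBounds` was retired in favour of the pre-shock stmt-14827, so the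
refuted statement is recorded here verbatim as the local `Retired9519.AprioriBounds` (dependency-drift
repair; statement text and content of the lemma unchanged).
-/

noncomputable section

open MeasureTheory Filter Set Topology
open scoped ENNReal

namespace Summit.AtomisticToContinuum.HydrodynamicLimit.Theorems.AprioriBoundsNegative

open Literature.MathematicalPhysics.KineticTheory Literature.Analysis.FluidPDE

/-! ### Record of the retired crux statement (stmt-AtomisticToContinuum-9519, the `∀ t > 0` form) -/

/-- **RECORD of the retired crux `AprioriBounds` (stmt-AtomisticToContinuum-9519, the `∀ t > 0` form;
verbatim its ledger signature).**  The route declaration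
`Summit.AtomisticToContinuum.HydrodynamicLimit.Theses.CollisionIsometryCLT.AprioriBounds` refuted below
(modulo `PersistentVacuum`) was RETIRED at route rev 12/13 (2026-08-16, dedup into the pre-shock
restatement stmt-14827 = `…Theses.StiffCollisionalRelaxation.AprioriBounds` =
`…Theses.CollisionIsometryCLT.AprioriBoundsPreShock`, which carries the repair `t < T` + dilute chamber
that the vacuum witness misses by construction) and no longer exists in the tree.  Its text is kept here
as a local definition so that the negative lemma keeps its exact content: for all continuous profiles
`a₀, θ₀ > 0`, `u₀` there is `σ₀ > 0` such that for all `0 < σ < σ₀`, every flow family `Φ` and EVERY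
`t > 0`: (i) a time-averaged one-particle exponential velocity moment on `[0, t]` is bounded w.h.p.;
(ii) for every admissible kernel family (`γ ≤ 1/15`) some `c₁ > 0` floors all block densities, and
`ρ̄σ³ ≤ 1`, at all times `s ≤ t`, w.h.p.  (Same text as the record `AprioriBounds` of
`Cruxes/AprioriBounds/Disproof.lean`; kept in the sub-namespace `Retired9519` and opened below, so the
lemma's statement reads verbatim as landed; importable by the sibling negative files of this folder.) -/
def Retired9519.AprioriBounds : Prop :=
  ∀ (a₀ θ₀ : (UnitAddTorus (Fin 3)) → ℝ) (u₀ : (UnitAddTorus (Fin 3)) → (EuclideanSpace ℝ (Fin 3))), Continuous a₀ → Continuous θ₀ → Continuous u₀ → (∀ x, 0 < a₀ x) → (∀ x, 0 < θ₀ x) → ∃ σ₀ : ℝ, 0 < σ₀ ∧ ∀ σ : ℝ, 0 < σ → σ < σ₀ → ∀ Φ : (N : ℕ) → Literature.Analysis.FluidPDE.HardSphereFlow (Literature.Analysis.FluidPDE.Torus.geometry (Fin 3)) (Literature.MathematicalPhysics.KineticTheory.hsDiameter σ N) (N + 1), ∀ t : ℝ, 0 < t → (∃ lam Cexp : ℝ,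 0 < lam ∧ Tendsto (fun N : ℕ => Literature.MathematicalPhysics.KineticTheory.localGibbsLaw σ a₀ u₀ θ₀ N (Φ N) {z | Cexp < ∫ s in Icc 0 t, ∫ y, Real.exp (lam * ‖y.2‖ ^ 2) ∂(Literature.Analysis.FluidPDE.empiricalMeasure ((Φ N).flow s z))}) atTop (𝓝 0)) ∧ (∀ (γ C : ℝ) (φ : ℕ → (UnitAddTorus (Fin 3)) → ℝ), 0 < γ → γ ≤ 1 / 15 → ((∀ N, Literature.Analysis.FunctionSpaces.Torus.IsSmooth (φ N)) ∧ (∀ N y, 0 ≤ φ N y) ∧ (∀ N, ∫ y, φ N y = 1) ∧ (∀ (N : ℕ) y, ((N : ℝ) + 1) ^ (-γ) ≤ Literature.Analysis.FluidPDE.Torus.euclidDist y 0 → φ N y = 0) ∧ (∀ (N : ℕ) y, φ N y ≤ C * ((N : ℝ) + 1) ^ (3 * γ)) ∧ (∀ (N : ℕ) y, ‖Literature.Analysis.FunctionSpaces.Torus.gradient (φ N) y‖ ≤ C * ((N : ℝ) + 1) ^ (4 * γ))) → ∃ c₁ : ℝ, 0 < c₁ ∧ Tendsto (fun N : ℕ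 => Literature.MathematicalPhysics.KineticTheory.localGibbsLaw σ a₀ u₀ θ₀ N (Φ N) {z | ∃ s ∈ Icc 0 t, ∃ x : (UnitAddTorus (Fin 3)), Literature.MathematicalPhysics.KineticTheory.empiricalDensityField ((Φ N).flow s z) (fun y => φ N (y - x)) < c₁ ∨ 1 < Literature.MathematicalPhysics.KineticTheory.empiricalDensityField ((Φ N).flow s z) (fun y => φ N (y - x)) * σ ^ 3}) atTop (𝓝 0))

open Retired9519 (AprioriBounds)

/-! ### Deterministic core: a block floor bounds the tested mass from below -/

/-- Mathlib's distance on `𝕋³` is dominated by the minimal-image distance in the crux's orientation: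
`dist x y ≤ euclidDist (y - x) 0` (`= euclidDist y x`, the crux measures kernel supports from `0`). -/
theorem dist_le_euclidDist_sub_zero (x y : T3) : dist x y ≤ Torus.euclidDist (y - x) 0 := by
  have h : Torus.euclidDist (y - x) 0 = Torus.euclidDist y x := by
    rw [Torus.euclidDist_eq, Torus.euclidDist_eq, sub_zero]
  rw [h, dist_eq_norm, ← norm_sub_rev]
  exact Torus.norm_sub_le_euclidDist_holds y x

/-- **Block floor ⇒ tested-mass floor (deterministic, every configuration).**  Let `φ ≥ 0` be a
kernel of mass one vanishing outside the ball `{euclidDist · 0 < r}`, and `χ ≥ 0` a test function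
with `r`-modulus `ε` (`χ x ≤ χ y + ε` whenever `euclidDist (y - x) 0 < r`).  If EVERY block of the
configuration `w` has density at least `c₁` (`c₁ ≤ (N+1)⁻¹∑ᵢ φ(xᵢ - x)` for all `x`), then the tested
mass is at least `c₁ ∫χ - ε`:  `c₁ ∫ χ ≤ (N+1)⁻¹ ∑ᵢ χ(xᵢ) + ε`.  (Integrate the floor against `χ`
and use that `φ(xᵢ - ·)` is a probability density concentrated where `χ ≤ χ(xᵢ) + ε`.) -/
theorem le_empiricalDensityField_of_blockFloor {N : ℕ} (w : Config (N + 1) (Fin 3) T3)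
    {φ : T3 → ℝ} (hφ0 : ∀ y, 0 ≤ φ y) (hφi : Integrable φ) (hφ1 : ∫ y, φ y = 1) {r : ℝ}
    (hsupp : ∀ y, r ≤ Torus.euclidDist y 0 → φ y = 0)
    {χ : T3 → ℝ} (hχc : Continuous χ) (hχ0 : ∀ x, 0 ≤ χ x) (hχ1 : ∀ x, χ x ≤ 1) {ε : ℝ}
    (hmod : ∀ x y : T3, Torus.euclidDist (y - x) 0 < r → χ x ≤ χ y + ε)
    {c₁ : ℝ} (hfloor : ∀ x, c₁ ≤ empiricalDensityField w (fun y => φ (y - x))) :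
    c₁ * ∫ x, χ x ≤ empiricalDensityField w χ + ε := by
  haveI : (volume : Measure T3).IsNegInvariant :=
    Measure.IsAddHaarMeasure.isNegInvariant_of_regular _
  have hχm : Measurable χ := hχc.measurable
  have hχi : Integrable χ := by
    refine Integrable.of_bound (μ := volume) hχc.aestronglyMeasurable 1
      (Eventually.of_forall fun x => ?_)
    rw [Real.norm_eq_abs, abs_of_nonneg (hχ0 x)]
    exact hχ1 x
  -- the block density as a finite sum
  set c : ℝ := ((N + 1 : ℕ) : ℝ)⁻¹ with hc
  have hc0 : 0 ≤ c := by positivity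
  have hρ : ∀ x, empiricalDensityField w (fun y => φ (y - x)) = c * ∑ i, φ ((w i).1 - x) :=
    fun x => blockDensity_eq w φ x
  -- each translated kernel, integrated against `χ`, is at most `χ(xᵢ) + ε`
  have hterm_int : ∀ i : Fin (N + 1), Integrable fun x => χ x * φ ((w i).1 - x) := fun i =>
    (hφi.comp_sub_left (w i).1).bdd_mul hχc.aestronglyMeasurable
      (Eventually.of_forall fun x => by
        rw [Real.norm_eq_abs, abs_of_nonneg (hχ0 x)]; exact hχ1 x)
  have hterm : ∀ i : Fin (N + 1), ∫ x, χ x * φ ((w i).1 - x) ≤ χ (w i).1 + ε := by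
    intro i
    have hpt : ∀ x, χ x * φ ((w i).1 - x) ≤ (χ (w i).1 + ε) * φ ((w i).1 - x) := by
      intro x
      by_cases h0 : φ ((w i).1 - x) = 0
      · simp [h0]
      · have hlt : Torus.euclidDist ((w i).1 - x) 0 < r := by
          by_contra hge
          exact h0 (hsupp _ (not_lt.1 hge))
        exact mul_le_mul_of_nonneg_right (hmod x (w i).1 hlt) (hφ0 _)
    calc ∫ x, χ x * φ ((w i).1 - x) ≤ ∫ x, (χ (w i).1 + ε) * φ ((w i).1 - x) :=
          integral_mono (hterm_int i) ((hφi.comp_sub_left (w i).1).const_mul _) hpt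
      _ = (χ (w i).1 + ε) * ∫ x, φ ((w i).1 - x) := integral_const_mul _ _
      _ = (χ (w i).1 + ε) * 1 := by rw [integral_sub_left_eq_self φ volume, hφ1]
      _ = χ (w i).1 + ε := mul_one _
  -- integrate the floor against `χ`
  have hprod_eq : (fun x => χ x * empiricalDensityField w (fun y => φ (y - x))) =
      fun x => c * ∑ i, χ x * φ ((w i).1 - x) := by
    funext x; rw [hρ x, Finset.mul_sum, Finset.mul_sum, Finset.mul_sum]
    refine Finset.sum_congr rfl fun i _ => ?_; ring
  have hprod_int : Integrable fun x => χ x * empiricalDensityField w (fun y => φ (y - x)) := by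
    rw [hprod_eq]; exact (integrable_finsetSum _ fun i _ => hterm_int i).const_mul _
  have hlow : c₁ * ∫ x, χ x ≤ ∫ x, χ x * empiricalDensityField w (fun y => φ (y - x)) := by
    rw [← integral_const_mul]
    refine integral_mono (hχi.const_mul _) hprod_int fun x => ?_
    have := mul_le_mul_of_nonneg_left (hfloor x) (hχ0 x)
    linarith [mul_comm c₁ (χ x)]
  have hup : ∫ x, χ x * empiricalDensityField w (fun y => φ (y - x)) ≤
      empiricalDensityField w χ + ε := by
    rw [hprod_eq, integral_const_mul, integral_finsetSum _ (fun i _ => hterm_int i),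
      empiricalDensityField_eq_sum]
    have hsum : ∑ i, ∫ x, χ x * φ ((w i).1 - x) ≤ ∑ i, (χ (w i).1 + ε) :=
      Finset.sum_le_sum fun i _ => hterm i
    have h1 : c * ∑ i : Fin (N + 1), (χ (w i).1 + ε) = c * ∑ i, χ (w i).1 + ε := by
      rw [Finset.sum_add_distrib, Finset.sum_const, Finset.card_univ, Fintype.card_fin,
        nsmul_eq_mul, mul_add, ← mul_assoc c, hc, inv_mul_cancel₀ (by positivity), one_mul]
    calc c * ∑ i, ∫ x, χ x * φ ((w i).1 - x) ≤ c * ∑ i, (χ (w i).1 + ε) :=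
          mul_le_mul_of_nonneg_left hsum hc0
      _ = c * ∑ i, χ (w i).1 + ε := h1
  exact hlow.trans hup

/-! ### Time integration along a good orbit -/

/-- Along the orbit of a good point, a pointwise floor `L ≤ (N+1)⁻¹∑ᵢ χ(xᵢ(s))` on `[t₁, t₂]`
integrates to `L (t₂ - t₁) ≤ ∫_{[t₁,t₂]} (N+1)⁻¹∑ᵢ χ(xᵢ(s)) ds` (the tested mass is measurable in
time along hard-sphere trajectories and takes values in `[0, 1]` for `0 ≤ χ ≤ 1`). -/
theorem mul_le_setIntegral_empiricalDensityField {N : ℕ} {ε' : ℝ}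
    (Φ : HardSphereFlow (Torus.geometry (Fin 3)) ε' (N + 1)) {z : Config (N + 1) (Fin 3) T3}
    (hz : z ∈ Φ.good) {χ : T3 → ℝ} (hχc : Continuous χ) (hχ0 : ∀ x, 0 ≤ χ x) (hχ1 : ∀ x, χ x ≤ 1)
    {t₁ t₂ L : ℝ} (ht : t₁ ≤ t₂)
    (hL : ∀ s ∈ Icc t₁ t₂, L ≤ empiricalDensityField (Φ.flow s z) χ) :
    L * (t₂ - t₁) ≤ ∫ s in Icc t₁ t₂, empiricalDensityField (Φ.flow s z) χ := by
  set γ : ℝ → Config (N + 1) (Fin 3) T3 := fun s => Φ.flow s z with hγ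
  have htraj : IsHardSphereTrajectory (Torus.geometry (Fin 3)) ε' (N + 1) γ := Φ.isTrajectory z hz
  have hγm : Measurable γ := htraj.measurable_torus
  have hχm : Measurable χ := hχc.measurable
  set c : ℝ := ((N + 1 : ℕ) : ℝ)⁻¹ with hc
  have hmwm : Measurable fun w : Config (N + 1) (Fin 3) T3 => empiricalDensityField w χ := by
    have : (fun w : Config (N + 1) (Fin 3) T3 => empiricalDensityField w χ) =
        fun w => c * ∑ i, χ (w i).1 := funext fun w => empiricalDensityField_eq_sum w χ
    rw [this]
    exact measurable_const.mul (Finset.measurable_sum _ fun i _ =>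
      hχm.comp (measurable_pi_apply i).fst)
  set m : ℝ → ℝ := fun s => empiricalDensityField (Φ.flow s z) χ with hm
  have hmm : Measurable m := hmwm.comp hγm
  have hmb : ∀ s, 0 ≤ m s ∧ m s ≤ 1 := fun s => empiricalDensityField_mem_Icc hχ0 hχ1 _
  haveI : IsFiniteMeasure (volume.restrict (Icc t₁ t₂)) := by infer_instance
  have hmi : Integrable m (volume.restrict (Icc t₁ t₂)) :=
    Integrable.of_bound hmm.aestronglyMeasurable 1 (Eventually.of_forall fun s => by
      rw [Real.norm_eq_abs, abs_of_nonneg (hmb s).1]; exact (hmb s).2)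
  have hae : ∀ᵐ s ∂(volume.restrict (Icc t₁ t₂)), (fun _ => L) s ≤ m s :=
    ae_restrict_of_forall_mem measurableSet_Icc fun s hs => hL s hs
  have hmono : ∫ s in Icc t₁ t₂, (fun _ => L) s ≤ ∫ s in Icc t₁ t₂, m s :=
    integral_mono_ae (integrable_const L) hmi hae
  have hconst : ∫ s in Icc t₁ t₂, (fun _ : ℝ => L) s = L * (t₂ - t₁) := by
    simp only
    rw [setIntegral_const, smul_eq_mul, Measure.real, Real.volume_Icc,
      ENNReal.toReal_ofReal (by linarith), mul_comm]
  rw [← hconst]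
  exact hmono

/-! ### The hypothesis `PersistentVacuum` and the negative lemma -/

/-- **H = `PersistentVacuum`** (HYPOTHESIS of a negative lemma; deliberately NOT tagged as a literature
fact — nobody has proved it for hard spheres).  For SOME admissible profiles `(a₀, θ₀, u₀)` (continuous,
`a₀, θ₀ > 0`) there is `σ₁ > 0` such that for all `0 < σ < σ₁` and every hard-sphere flow family `Φ`
there are a window `0 ≤ t₁ < t₂` and a window-integrated limit density `ρI : 𝕋³ → ℝ` with
(1) SPACE–TIME LAW OF LARGE NUMBERS FOR THE DENSITY: for every continuous `χ` and `δ > 0`, under the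
local Gibbs laws `|∫_{t₁}^{t₂} (N+1)⁻¹∑ᵢ χ(xᵢ(s)) ds - ∫ χ ρI| ≤ δ` with probability `→ 1`;
(2) VACUUM: for every `c > 0` some continuous `0 ≤ χ ≤ 1` with `∫χ > 0` has `∫ χ ρI < c ∫ χ`
(window-integrated mass below every positive multiple of the tested volume: `ρI` vanishes somewhere in
the tested sense — e.g. `ρI` continuous with a zero).  Gas dynamics predicts (1)–(2) behind the reflected
shock of a converging (Guderley) implosion (density `∝ r^κ → 0` at the focus for all later times:
Zel'dovich–Raizer, Physics of Shock Waves (2002) Ch. XII §§5–9; Sachdev, Shock Waves and Explosions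
(2004) §6.1, §3.8; Lazarus, SIAM J. Numer. Anal. 18 (1981) 316–371) and in cavitating flows; proving it
for the particle system is a hydrodynamic limit THROUGH a collapse. -/
def PersistentVacuum : Prop :=
  ∃ (a₀ θ₀ : T3 → ℝ) (u₀ : T3 → V3), Continuous a₀ ∧ Continuous θ₀ ∧ Continuous u₀ ∧
    (∀ x, 0 < a₀ x) ∧ (∀ x, 0 < θ₀ x) ∧
    ∃ σ₁ : ℝ, 0 < σ₁ ∧ ∀ σ : ℝ, 0 < σ → σ < σ₁ →
      ∀ Φ : (N : ℕ) → HardSphereFlow (Torus.geometry (Fin 3)) (hsDiameter σ N) (N + 1),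
        ∃ t₁ t₂ : ℝ, 0 ≤ t₁ ∧ t₁ < t₂ ∧ ∃ ρI : T3 → ℝ,
          (∀ χ : T3 → ℝ, Continuous χ → ∀ δ : ℝ, 0 < δ →
            Tendsto (fun N : ℕ => localGibbsLaw σ a₀ u₀ θ₀ N (Φ N)
              {z | δ < |(∫ s in Icc t₁ t₂, empiricalDensityField ((Φ N).flow s z) χ) -
                ∫ x, χ x * ρI x|}) atTop (𝓝 0)) ∧
          (∀ c : ℝ, 0 < c → ∃ χ : T3 → ℝ, Continuous χ ∧ (∀ x, 0 ≤ χ x) ∧ (∀ x, χ x ≤ 1) ∧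
            0 < ∫ x, χ x ∧ (∫ x, χ x * ρI x) < c * ∫ x, χ x)

/-- **Negative lemma modulo `PersistentVacuum`.**  If, along some window, the tested empirical density
of the hard-sphere gas under local Gibbs data obeys a law of large numbers toward a limit with vacuum
(as gas dynamics predicts behind the reflected shock of an implosion, or in a cavity), then
the retired `∀ t > 0` crux `AprioriBounds` (stmt-9519, recorded verbatim as `Retired9519.AprioriBounds`)
is FALSE: its component (ii) claims for every `t > 0` — past the collapse too — and
every admissible kernel family a floor `c₁ > 0` under all block densities at all times `s ≤ t` w.h.p.,
which forces `∫_{t₁}^{t₂}(N+1)⁻¹∑ᵢχ(xᵢ(s))ds ≥ (t₂ - t₁)(c₁∫χ - o(1))` for every continuous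
`0 ≤ χ ≤ 1` (`le_empiricalDensityField_of_blockFloor` + uniform continuity of `χ` + the shrinking
kernel supports), contradicting (1) at the `χ` of (2) with `c = c₁(t₂ - t₁)/2`.  The admissible kernel
family used is the tree's torus mollifier (`exists_admissibleKernelFamily`).  REPAIR (the witness misses
it): restrict `t` to `t < T`, `T` the classical existence time (`AprioriBoundsRepaired`, Disproof §6). -/
theorem AprioriBounds_false_of_PersistentVacuum : PersistentVacuum → ¬ AprioriBounds := by
  rintro ⟨a₀, θ₀, u₀, ha, hθ, hu, ha0, hθ0, σ₁, hσ₁, hH⟩ hAB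
  obtain ⟨σ₀, hσ₀, hA⟩ := hAB a₀ θ₀ u₀ ha hθ hu ha0 hθ0
  -- a common small reduced density
  have hmin : 0 < min (min σ₀ σ₁) (1 / 2) := lt_min (lt_min hσ₀ hσ₁) (by norm_num)
  set σ : ℝ := min (min σ₀ σ₁) (1 / 2) / 2 with hσdef
  have hσ : 0 < σ := half_pos hmin
  have hσlt : σ < min (min σ₀ σ₁) (1 / 2) := half_lt_self hmin
  have hσσ₀ : σ < σ₀ := hσlt.trans_le ((min_le_left _ _).trans (min_le_left _ _))
  have hσσ₁ : σ < σ₁ := hσlt.trans_le ((min_le_left _ _).trans (min_le_right _ _))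
  have hσ2 : σ < 1 / 2 := hσlt.trans_le (min_le_right _ _)
  -- a flow family (Alexander's theorem)
  set Φ : (N : ℕ) → HardSphereFlow (Torus.geometry (Fin 3)) (hsDiameter σ N) (N + 1) :=
    fun N => Alexander.regHardSphereFlow (d := Fin 3) (hsDiameter_pos hσ N)
      ((hsDiameter_le hσ.le N).trans_lt (by linarith)) (N + 1) with hΦ
  obtain ⟨t₁, t₂, ht₁, ht₁₂, ρI, hconv, hvac⟩ := hH σ hσ hσσ₁ Φ
  have ht₂ : 0 < t₂ := ht₁.trans_lt ht₁₂
  have hΔ : 0 < t₂ - t₁ := sub_pos.2 ht₁₂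
  -- the admissible kernel family and the floor `c₁` claimed by (ii) at `t = t₂`
  obtain ⟨γ, C, φ, hγ, hγ', hsm, hnn, hmass, hsupp, hsup, hgrad, hint⟩ :=
    exists_admissibleKernelFamily
  obtain ⟨c₁, hc₁, hT⟩ := (hA σ hσ hσσ₀ Φ t₂ ht₂).2 γ C φ hγ hγ' ⟨hsm, hnn, hmass, hsupp, hsup, hgrad⟩
  -- the vacuum test function at level `c = c₁ (t₂ - t₁) / 2`
  obtain ⟨χ, hχc, hχ0, hχ1, hI, hM⟩ := hvac (c₁ * (t₂ - t₁) / 2) (by positivity)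
  set I : ℝ := ∫ x, χ x with hIdef
  set M : ℝ := ∫ x, χ x * ρI x with hMdef
  -- LLN tolerance and modulus of continuity
  set δ : ℝ := c₁ * (t₂ - t₁) * I / 4 with hδdef
  have hδ0 : 0 < δ := by positivity
  have hB := hconv χ hχc δ hδ0
  set ε : ℝ := c₁ * I / 8 with hεdef
  have hε0 : 0 < ε := by positivity
  obtain ⟨η, hη0, hηmod⟩ := Metric.uniformContinuous_iff.1
    (CompactSpace.uniformContinuous_of_continuous hχc) ε hε0
  -- the kernel radius is eventually below `η`
  have hrad : Tendsto (fun N : ℕ => ((N : ℝ) + 1) ^ (-γ)) atTop (𝓝 0) :=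
    (tendsto_rpow_neg_atTop hγ).comp
      (tendsto_atTop_add_const_right _ 1 tendsto_natCast_atTop_atTop)
  obtain ⟨N₁, hN₁⟩ := eventually_atTop.1 (hrad.eventually (gt_mem_nhds hη0))
  -- the events
  set P : (N : ℕ) → Measure (Config (N + 1) (Fin 3) T3) :=
    fun N => localGibbsLaw σ a₀ u₀ θ₀ N (Φ N) with hPdef
  set Bad : (N : ℕ) → Set (Config (N + 1) (Fin 3) T3) := fun N =>
    {z | ∃ s ∈ Icc 0 t₂, ∃ x : T3,
      empiricalDensityField ((Φ N).flow s z) (fun y => φ N (y - x)) < c₁ ∨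
        1 < empiricalDensityField ((Φ N).flow s z) (fun y => φ N (y - x)) * σ ^ 3} with hBaddef
  set B1 : (N : ℕ) → Set (Config (N + 1) (Fin 3) T3) := fun N =>
    {z | δ < |(∫ s in Icc t₁ t₂, empiricalDensityField ((Φ N).flow s z) χ) - M|} with hB1def
  -- deterministic covering for `N ≥ N₁`
  have hcover : ∀ N, N₁ ≤ N → (univ : Set (Config (N + 1) (Fin 3) T3)) ⊆
      Bad N ∪ B1 N ∪ ((Φ N).good)ᶜ := by
    intro N hN z _
    by_cases hz : z ∈ (Φ N).good
    · by_cases h1 : δ < |(∫ s in Icc t₁ t₂, empiricalDensityField ((Φ N).flow s z) χ) - M|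
      · exact Or.inl (Or.inr h1)
      by_cases hbad : z ∈ Bad N
      · exact Or.inl (Or.inl hbad)
      -- no bad block on `[0, t₂]`, LLN `δ`-good: derive a contradiction
      exfalso
      have hfloor : ∀ s ∈ Icc t₁ t₂, ∀ x,
          c₁ ≤ empiricalDensityField ((Φ N).flow s z) (fun y => φ N (y - x)) := by
        intro s hs x
        by_contra hlt
        exact hbad ⟨s, ⟨ht₁.trans hs.1, hs.2⟩, x, Or.inl (not_le.1 hlt)⟩
      have hmod : ∀ x y : T3, Torus.euclidDist (y - x) 0 < ((N : ℝ) + 1) ^ (-γ) →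
          χ x ≤ χ y + ε := by
        intro x y hxy
        have hd : dist x y < η := (dist_le_euclidDist_sub_zero x y).trans_lt (hxy.trans (hN₁ N hN))
        have := hηmod hd
        rw [Real.dist_eq] at this
        linarith [(abs_lt.1 this).1, (abs_lt.1 this).2]
      have hpt : ∀ s ∈ Icc t₁ t₂,
          c₁ * I - ε ≤ empiricalDensityField ((Φ N).flow s z) χ := by
        intro s hs
        have := le_empiricalDensityField_of_blockFloor ((Φ N).flow s z) (hnn N) (hint N) (hmass N)
          (hsupp N) hχc hχ0 hχ1 hmod (hfloor s hs)
        linarith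
      have hlowint : (c₁ * I - ε) * (t₂ - t₁) ≤
          ∫ s in Icc t₁ t₂, empiricalDensityField ((Φ N).flow s z) χ :=
        mul_le_setIntegral_empiricalDensityField (Φ N) hz hχc hχ0 hχ1 ht₁₂.le hpt
      have hupint : (∫ s in Icc t₁ t₂, empiricalDensityField ((Φ N).flow s z) χ) ≤ M + δ := by
        have := (abs_le.1 (not_lt.1 h1)).2
        linarith
      -- arithmetic: `(c₁ I - c₁ I/8)(t₂ - t₁) ≤ M + c₁ (t₂ - t₁) I/4 < (3/4) c₁ (t₂ - t₁) I`
      have hM' : M < c₁ * (t₂ - t₁) / 2 * I := hM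
      have hpos : 0 < c₁ * I * (t₂ - t₁) := by positivity
      rw [hεdef] at hlowint
      rw [hδdef] at hupint
      nlinarith
    · exact Or.inr hz
  have hbound : ∀ N, N₁ ≤ N → (1 : ℝ≥0∞) ≤ P N (Bad N) + P N (B1 N) := by
    intro N hN
    haveI := isProbabilityMeasure_localGibbsLaw ha hθ hu ha0 hθ0 hσ2.le N (Φ N)
    have hg : P N ((Φ N).good)ᶜ = 0 := by
      rw [hPdef]
      show localGibbsLaw σ a₀ u₀ θ₀ N (Φ N) ((Φ N).good)ᶜ = 0
      rw [localGibbsLaw_eq]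
      exact localGibbsMeasure_absolutelyContinuous σ a₀ u₀ θ₀ N (Φ N) (Φ N).measure_compl_good
    calc (1 : ℝ≥0∞) = P N univ := measure_univ.symm
      _ ≤ P N (Bad N ∪ B1 N ∪ ((Φ N).good)ᶜ) := measure_mono (hcover N hN)
      _ ≤ P N (Bad N ∪ B1 N) + P N ((Φ N).good)ᶜ := measure_union_le _ _
      _ ≤ P N (Bad N) + P N (B1 N) + P N ((Φ N).good)ᶜ :=
          add_le_add (measure_union_le _ _) le_rfl
      _ = P N (Bad N) + P N (B1 N) := by rw [hg, add_zero]
  have hlim : Tendsto (fun N => P N (Bad N) + P N (B1 N)) atTop (𝓝 0) := by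
    have h := hT.add hB
    rw [add_zero] at h
    exact h
  have h10 : (1 : ℝ≥0∞) ≤ 0 :=
    ge_of_tendsto hlim (eventually_atTop.2 ⟨N₁, fun N hN => hbound N hN⟩)
  exact absurd h10 (by norm_num)

end Summit.AtomisticToContinuum.HydrodynamicLimit.Theorems.AprioriBoundsNegative

end
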